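import Summits.ResolutionOfSingularities.ResolutionOfSingularities.Theorems.MarkedTransferCampaignW46MohWindowShadeAnchorChart
import HarnessLib

/-!
# [OURS · L1 W4.6 rung (iii-2), ENTRANCE DOOR, brick 4b] The scheme-level hit step of a polynomial anchor: at a singular point over a
# blown-up anchored point the controlled transform carries the anchor `PointBlowup.step` in the Hauser–Wagner frame, at an
# EQUIMULTIPLE point

Cell `res-hironaka`, LADDER-RESOLUTION rung L (D-0089), slot W4.6 rung (iii); seat res-L1-s46-pv-6 (gen 4). Host route MarkedTransfer,
`--supports stmt-ResolutionOfSingularities-16155 --as helper`; kind proof (no definition).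

WHAT. For a blow-up `π : Z′ → Z` of an ambient datum along the closed point `ξ = π ξ′`, `ξ′ ∈ Sing(E′)` (`E′` the transform,
`E.b = p`) with `𝒪_{Z′,ξ′}` regular (the regime upstairs), and a POLYNOMIAL ANCHOR at `ξ` — a regular system of parameters `(x, y, z)`
of `𝒪_{Z,ξ}` (regular, embedding dimension `3`), constants `κ`, a state `s` of this seat's shade model (`PointBlowup.State`, letters
`σ = {j, i}`) with `J_ξ = (z^p + F_s(x, y))` (`y_j ↦ x`, `y_i ↦ y`), `ord F_s ≥ p` — together with constants `κ′` at `ξ′` compatible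
with `κ` under `π^♯` over which `𝒪_{Z′,ξ′}` is residually rational (closed point, `K` algebraically closed: supplied by the assembly):
**`exists_anchor_step`** — there are a chart letter `c ∈ {j, i}`, a point `b` (`b_c = 0`; `b = 0` when `c = i`: the Hauser–Wagner
frame) and a regular system of parameters `(x′, y′, z′)` of `𝒪_{Z′,ξ′}` with `J′_{ξ′} = (z′^p + F_{s′}(x′, y′))` for
**`s′ = PointBlowup.step p c b s`**, and `b` IS AN EQUIMULTIPLE POINT of `s`. Mechanism (`exists_anchor_of_chart`): the tree's Rees-chart
presentation of `𝒪_{Z′,ξ′}` (`IsBlowup.exists_reesChart_stalk`); the chart containing `ξ′` read off the units among the quotients (the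
`z`-chart alone is impossible, `…AnchorChart.false_of_zChart`); recentring by constants (`…AnchorChart.exists_origin_chart_of_rational`);
the regular system `originFamily` (tree `NearPointTauOrigin`); the colon formula for the controlled transform (as in res-D-pv-050's
`…MohWindowSurfaceStep`); this seat's ring-level bricks `…AnchorCore` (A)/(B) and `…Anchor` (quasi-regular readings).

HONEST FRAMING. Nothing here is a statement of H. Hironaka's manuscript [Hironaka2017] (2017-03-23; Th. 16.6 p.84 — scope only, under
adjudication) and nothing asserts that any statement of it holds. AI-written; AI review is weaker than expert review. No `sorry`; axioms
standard; one declaration with raised `maxHeartbeats` (size of the context, not search). References: The Stacks Project, Tag 0804;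
H. Hauser, Bull. AMS 47 (2010) §§F–G. [StacksProject] [Hauser2010] [folklore]
-/

noncomputable section

set_option linter.dupNamespace false -- mandated namespace of this single-conjunct summit

open CategoryTheory AlgebraicGeometry TopologicalSpace IsLocalRing MvPolynomial

namespace Summit.ResolutionOfSingularities.ResolutionOfSingularities.Theorems

namespace CampaignW46

namespace MohWindowShadeAnchorStep

open Literature.AlgebraicGeometry.Resolution
open Literature.AlgebraicGeometry.Resolution.PointBlowup
open Literature.AlgebraicGeometry.Resolution.Hauser2010
open Literature.AlgebraicGeometry.Hironaka2017.S02Preliminaries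
open Literature.AlgebraicGeometry.Hironaka2017.Datum
open Literature.AlgebraicGeometry.Hironaka2017.S16Proof
open Scheme.IdealSheafData
open MohWindowShadeAnchorChart

universe u

variable {p : ℕ} [Fact p.Prime] {K : Type u} [Field K] [CharP K p] [DecidableEq K] [PerfectRing K p]
variable {σ : Type} [Fintype σ] [DecidableEq σ] {j i : σ}

set_option maxHeartbeats 800000 in
/-- **The anchor upstairs, given the chart.** Scheme context: `π` the blow-up of the ambient datum `A` along the closed point `π ξ′`
(`D = {π ξ′}`), `ξ′ ∈ Sing(E′)`, `E.b = p`; anchor `(c₀; κ; s)` at `π ξ′` with `J = (c₀ 2 ^ p + F_s(e))`, the letters `c, c̄` of `σ` read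
as `e c = c₀ m_c`, `e c̄ = c₀ m_c̄` (`{m_c, m_c̄} = {0, 1}`); `ξ′` lies in the chart of `c₀ m_c` (`π^♯ c₀ l = π^♯ c₀ m_c · ρ_l`) with
rational recentred quotients (`ρ_l − κ′ a_l ∈ 𝔪′`). Then `𝒪_{Z′,ξ′}` carries the anchor `PointBlowup.step p c b s`, `b = (c ↦ 0,
c̄ ↦ a_{m_c̄})`, at an EQUIMULTIPLE point `b`. [cite: StacksProject, Tag 0804] [cite: Hauser2010, §F (chart expressions of a point blowup)] -/
theorem exists_anchor_of_chart {A A' : AmbientDatum p K} {E : IdealExponent A.Z} {D : Closeds A.Z} (π : A'.Z ⟶ A.Z)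
    (hπ : IsBlowup π (vanishingIdeal D)) {ξ' : A'.Z} (hsing' : ξ' ∈ (E.transform π D).sing) (hb : E.b = p)
    [IsRegularLocalRing (A.Z.presheaf.stalk (π.base ξ'))]
    (h3 : (maximalIdeal (A.Z.presheaf.stalk (π.base ξ'))).spanFinrank = 3)
    (hreg' : IsRegularLocalRing (A'.Z.presheaf.stalk ξ'))
    (κ : K →+* A.Z.presheaf.stalk (π.base ξ')) (κ' : K →+* A'.Z.presheaf.stalk ξ')
    (hκκ' : ∀ l, (π.stalkMap ξ').hom (κ l) = κ' l)
    {c c' : σ} (hcc : c' ≠ c) (htwo : ∀ l, l = c ∨ l = c')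
    (c₀ : Fin 3 → A.Z.presheaf.stalk (π.base ξ')) (hc₀span : Ideal.span (Set.range c₀) = maximalIdeal _)
    (hc₀Y : Ideal.span (Set.range c₀) = stalkIdeal (vanishingIdeal D) (π.base ξ'))
    (e : σ → A.Z.presheaf.stalk (π.base ξ')) {mc mc' : Fin 3} (hcases : mc = 0 ∧ mc' = 1 ∨ mc = 1 ∧ mc' = 0)
    (hec : e c = c₀ mc) (hec' : e c' = c₀ mc')
    (s : State σ K) (hdeg : ∀ d ∈ s.F.support, p ≤ d.degree)
    (hJ : stalkIdeal E.J (π.base ξ') = Ideal.span {c₀ 2 ^ p + eval₂ κ e s.F})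
    (ρ : Fin 3 → A'.Z.presheaf.stalk ξ') (hρ : ∀ l, (π.stalkMap ξ').hom (c₀ l) = (π.stalkMap ξ').hom (c₀ mc) * ρ l)
    (hX0 : (π.stalkMap ξ').hom (c₀ mc) ≠ 0) (a : Fin 3 → K)
    (ha : ∀ l, l ≠ mc → ρ l - κ' (a l) ∈ maximalIdeal (A'.Z.presheaf.stalk ξ')) :
    ∃ (xc xc' w' : A'.Z.presheaf.stalk ξ'),
      IsEquimultiplePoint p c (fun l => if l = c then 0 else a mc') s ∧
      Ideal.span {xc, xc', w'} = maximalIdeal _ ∧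
      stalkIdeal (E.transform π D).J ξ' =
        Ideal.span {w' ^ p + eval₂ κ' (fun l => if l = c then xc else xc')
          (step p c (fun l => if l = c then 0 else a mc') s).F} := by
  classical
  haveI : IsLocallyNoetherian A'.Z := by
    haveI := A'.smooth
    exact LocallyOfFiniteType.isLocallyNoetherian A'.hom
  haveI := hreg'
  haveI : IsDomain (A'.Z.presheaf.stalk ξ') := isDomain_of_isRegularLocalRing _
  haveI : CharP (A'.Z.presheaf.stalk ξ') p := Lem16p11Proof.charP_stalk A π ξ'
  have hp1 : 1 ≤ p := (Fact.out : p.Prime).one_lt.le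
  set ψ := (π.stalkMap ξ').hom with hψ
  have hκ'e : ψ.comp κ = κ' := RingHom.ext hκκ'
  have hmc2 : mc ≠ 2 := by rcases hcases with ⟨rfl, -⟩ | ⟨rfl, -⟩ <;> decide
  have hmc'2 : mc' ≠ 2 := by rcases hcases with ⟨-, rfl⟩ | ⟨-, rfl⟩ <;> decide
  have hmm : mc' ≠ mc := by rcases hcases with ⟨rfl, rfl⟩ | ⟨rfl, rfl⟩ <;> decide
  have h2m : (2 : Fin 3) ≠ mc := fun h => hmc2 h.symm
  -- recentre: lifts of the constants downstairs
  set ã : {l : Fin 3 // l ≠ mc} → A.Z.presheaf.stalk (π.base ξ') := fun l => κ (a l) with hã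
  have hã' : ∀ l (hl : l ≠ mc), ρ l - ψ (ã ⟨l, hl⟩) ∈ maximalIdeal (A'.Z.presheaf.stalk ξ') := by
    intro l hl
    rw [hã]
    simp only
    rw [hκκ']
    exact ha l hl
  obtain ⟨c₂, hc₂⟩ : ∃ c₂, c₂ = shiftRsop c₀ mc ã := ⟨_, rfl⟩
  obtain ⟨𝔴, χ, hχ, hloc, h𝔴, he𝔴, hval⟩ := exists_origin_chart_of_rational hπ hc₀Y mc hX0 ρ hρ ã hã' c₂ hc₂
  letI := χ.toAlgebra
  haveI := hloc
  have hc₂span : Ideal.span (Set.range c₂) = maximalIdeal _ := by rw [hc₂, span_range_shiftRsop, hc₀span]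
  obtain ⟨-, h3', hspan'⟩ :=
    isRegularLocalRing_and_span_originFamily h3 c₂ hc₂span mc 𝔴.asIdeal h𝔴 he𝔴 (A'.Z.presheaf.stalk ξ')
  -- the new parameters
  set X' := ψ (c₀ mc) with hX'
  set V := χ (chartGen c₂ mc mc') with hV
  set W := χ (chartGen c₂ mc 2) with hW
  have hVρ : V = ρ mc' - κ' (a mc') := by rw [hV, hval mc' hmm, hã]; simp only; rw [hκκ']
  have hWρ : W = ρ 2 - κ' (a 2) := by rw [hW, hval 2 h2m, hã]; simp only; rw [hκκ']
  have horig_mc : originFamily c₂ mc (A'.Z.presheaf.stalk ξ') mc = X' := by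
    rw [originFamily_self]
    show χ (chartBase c₂ mc (c₂ mc)) = ψ (c₀ mc)
    rw [hχ, hc₂, shiftRsop_self]
  have horig_mc' : originFamily c₂ mc (A'.Z.presheaf.stalk ξ') mc' = V := by
    rw [originFamily_of_ne c₂ mc _ hmm]; rfl
  have horig_2 : originFamily c₂ mc (A'.Z.presheaf.stalk ξ') 2 = W := by
    rw [originFamily_of_ne c₂ mc _ h2m]; rfl
  have h𝔪' : Ideal.span {X', V, W} = maximalIdeal _ := by
    rw [← hspan', range_fin3]
    rcases hcases with ⟨rfl, rfl⟩ | ⟨rfl, rfl⟩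
    · rw [horig_mc, horig_mc', horig_2]
    · rw [horig_mc, horig_mc', horig_2, Set.insert_comm]
  -- relations for the ring-level core
  have heC : ψ (e c) = X' := by rw [hec]
  have heC' : ψ (e c') = X' * (V + ψ (κ (a mc'))) := by rw [hec', hρ mc', hVρ, hκκ', sub_add_cancel]
  have hw : ψ (c₀ 2) = X' * (W + ψ (κ (a 2))) := by rw [hρ 2, hWρ, hκκ', sub_add_cancel]
  set b : σ → K := fun l => if l = c then 0 else a mc' with hb'
  set e' : σ → A'.Z.presheaf.stalk ξ' := fun l => if l = c then X' else V with he'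
  have hA := MohWindowShadeAnchorCore.map_anchor_eq_mul_pointTransform p hcc htwo κ ψ e (c₀ 2) s hdeg (a mc') (a 2)
    heC heC' hw
  obtain ⟨w', q', hB, hrelW⟩ := MohWindowShadeAnchorCore.exists_map_anchor_eq_mul_step p hcc htwo κ ψ e (c₀ 2) s
    hdeg (a mc') (a 2) heC heC' hw
  -- the transform stalk as a colon
  have hbE' : (E.transform π D).b = E.b := rfl
  have hCmap : (stalkIdeal (vanishingIdeal D) (π.base ξ')).map ψ = Ideal.span {X'} := by
    rw [← hc₀Y, Ideal.map_span_range_eq_span_singleton _ c₀ mc _ hρ]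
  have hstalk : stalkIdeal (E.transform π D).J ξ' =
      Submodule.colon (Ideal.span {ψ (c₀ 2 ^ p + eval₂ κ e s.F)}) ((Ideal.span {X'} ^ p : Ideal _) : Set _) := by
    show stalkIdeal (controlledTransform π (vanishingIdeal D) E.J E.b) ξ' = _
    rw [controlledTransform, stalkIdeal_colon, stalkIdeal_pow, stalkIdeal_comap_eq_map_stalkMap,
      stalkIdeal_comap_eq_map_stalkMap, ← hψ, hCmap, hJ, Ideal.map_span, Set.image_singleton, hb]
  have hsing : stalkIdeal (E.transform π D).J ξ' ≤ maximalIdeal _ ^ p := by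
    have := (le_idealOrder_iff (E.transform π D).J ξ' (E.transform π D).b).mp hsing'
    rwa [hbE', hb] at this
  have hX0' : X' ∈ nonZeroDivisors (A'.Z.presheaf.stalk ξ') := mem_nonZeroDivisors_of_ne_zero hX0
  have hJA : stalkIdeal (E.transform π D).J ξ' =
      Ideal.span {W ^ p + eval₂ (ψ.comp κ) e' (pointTransform p c b s + C (a 2 ^ p))} := by
    rw [hstalk, hA, MohWindowSurface.colon_span_pow_mul hX0']
  have hJB : stalkIdeal (E.transform π D).J ξ' = Ideal.span {w' ^ p + eval₂ (ψ.comp κ) e' (step p c b s).F} := by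
    rw [hstalk, hB, MohWindowSurface.colon_span_pow_mul hX0']
  -- equimultiplicity
  have heq : IsEquimultiplePoint p c b s := by
    refine MohWindowShadeAnchorCore.isEquimultiplePoint_of_le_ordZero_add_C p (u := a 2 ^ p) ?_
    refine MohWindowShadeAnchor.natCast_le_ordZero_of_span_le_pow₂ hreg' h3' h𝔪' (ψ.comp κ) hcc htwo ?_
    rw [← hJA]
    exact hsing
  -- `w' ∈ 𝔪′` and the new regular system `(X', V, w')`
  have hle : Ideal.span {X', V} ≤ maximalIdeal (A'.Z.presheaf.stalk ξ') := by
    rw [← h𝔪']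
    apply Ideal.span_mono
    intro r hr
    rcases hr with rfl | rfl
    · exact Set.mem_insert _ _
    · exact Set.mem_insert_of_mem _ (Set.mem_insert _ _)
  have hWm : W ∈ maximalIdeal (A'.Z.presheaf.stalk ξ') :=
    h𝔪' ▸ Ideal.subset_span (Set.mem_insert_of_mem _ (Set.mem_insert_of_mem _ (Set.mem_singleton _)))
  have hstep0 : coeff 0 (step p c b s).F = 0 := by
    show coeff 0 (deletePthPowers p (pointTransform p c b s)) = 0
    rw [coeff_deletePthPowers, if_pos]
    intro l hl
    simp at hl
  have hstepm : eval₂ (ψ.comp κ) e' (step p c b s).F ∈ maximalIdeal _ :=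
    hle (MohWindowShadeAnchorCore.eval₂_mem_span_pair_of_coeff_zero (c := c) (ψ.comp κ) X' V hstep0)
  have hw'm : w' ∈ maximalIdeal (A'.Z.presheaf.stalk ξ') := by
    have hgen : w' ^ p + eval₂ (ψ.comp κ) e' (step p c b s).F ∈ maximalIdeal _ ^ p :=
      hsing (by rw [hJB]; exact Ideal.mem_span_singleton_self _)
    have h1 : w' ^ p ∈ maximalIdeal _ := by
      have := Ideal.sub_mem _ (Ideal.pow_le_self (by omega) hgen) hstepm
      rwa [add_sub_cancel_right] at this
    exact Ideal.IsPrime.mem_of_pow_mem inferInstance p h1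
  have hq0 : q' = 0 := by
    have h2 : ψ (κ q') ∈ maximalIdeal _ := by
      have := Ideal.sub_mem _ (Ideal.sub_mem _ hWm hw'm) (hle hrelW)
      rwa [sub_sub_cancel] at this
    rw [hκκ'] at h2
    exact eq_zero_of_map_mem_maximalIdeal κ' h2
  have hWw' : W - w' ∈ Ideal.span {X', V} := by
    have := hrelW
    rwa [hq0, map_zero, map_zero, sub_zero] at this
  have h𝔪'' : Ideal.span {X', V, w'} = maximalIdeal _ := by
    rw [← h𝔪']
    have hsub : Ideal.span {X', V} ≤ Ideal.span {X', V, w'} := Ideal.span_mono fun r hr => by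
      rcases hr with rfl | rfl
      · exact Set.mem_insert _ _
      · exact Set.mem_insert_of_mem _ (Set.mem_insert _ _)
    have hsub' : Ideal.span {X', V} ≤ Ideal.span {X', V, W} := Ideal.span_mono fun r hr => by
      rcases hr with rfl | rfl
      · exact Set.mem_insert _ _
      · exact Set.mem_insert_of_mem _ (Set.mem_insert _ _)
    apply le_antisymm
    · rw [Ideal.span_le]
      rintro r (rfl | rfl | hr)
      · exact Ideal.subset_span (Set.mem_insert _ _)
      · exact Ideal.subset_span (Set.mem_insert_of_mem _ (Set.mem_insert _ _))
      · rw [Set.mem_singleton_iff] at hr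
        rw [hr, SetLike.mem_coe, show w' = W - (W - w') by ring]
        exact Ideal.sub_mem _ (Ideal.subset_span (Set.mem_insert_of_mem _ (Set.mem_insert_of_mem _ rfl))) (hsub' hWw')
    · rw [Ideal.span_le]
      rintro r (rfl | rfl | hr)
      · exact Ideal.subset_span (Set.mem_insert _ _)
      · exact Ideal.subset_span (Set.mem_insert_of_mem _ (Set.mem_insert _ _))
      · rw [Set.mem_singleton_iff] at hr
        rw [hr, SetLike.mem_coe, show W = w' + (W - w') by ring]
        exact Ideal.add_mem _ (Ideal.subset_span (Set.mem_insert_of_mem _ (Set.mem_insert_of_mem _ rfl))) (hsub hWw')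
  refine ⟨X', V, w', heq, h𝔪'', ?_⟩
  rw [hJB, hκ'e]

/-- **THE HIT STEP.** [OURS · L1 W4.6 rung (iii-2)] NOT a statement of the manuscript. `π : Z′ → Z` the blow-up of the ambient datum
along the closed point `π ξ′` (`D = {π ξ′}`), `ξ′ ∈ Sing(E′)` with `𝒪_{Z′,ξ′}` regular (the regime upstairs), `E.b = p`; a polynomial
anchor `J_{πξ′} = (z^p + F_s(x, y))` at `π ξ′` (`(x, y, z)` a regular system of parameters, `ord F_s ≥ p`, letters `y_j ↦ x`, `y_i ↦ y`);
constants `κ`, `κ′` compatible under `π^♯` with `𝒪_{Z′,ξ′}` residually rational over `κ′`. Then for some chart letter `c ∈ {j, i}` and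
point `b` IN THE HAUSER–WAGNER FRAME (`b_c = 0`; `b = 0` if `c = i`), `b` is an EQUIMULTIPLE point of `s` and `𝒪_{Z′,ξ′}` carries the
anchor `J′_{ξ′} = (z′^p + F_{s′}(x′, y′))`, `s′ = PointBlowup.step p c b s`, `(x′, y′, z′)` a regular system of parameters.
[cite: StacksProject, Tag 0804] [cite: Hauser2010, §F (chart expressions of a point blowup)] -/
theorem exists_anchor_step {A A' : AmbientDatum p K} {E : IdealExponent A.Z} {D : Closeds A.Z} (π : A'.Z ⟶ A.Z)
    (hπ : IsBlowup π (vanishingIdeal D)) {ξ' : A'.Z}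
    (hD : (D : Set A.Z) = {π.base ξ'}) (hξcl : IsClosed ({π.base ξ'} : Set A.Z))
    (hsing' : ξ' ∈ (E.transform π D).sing) (hb : E.b = p)
    [IsRegularLocalRing (A.Z.presheaf.stalk (π.base ξ'))]
    (h3 : (maximalIdeal (A.Z.presheaf.stalk (π.base ξ'))).spanFinrank = 3)
    (hreg' : IsRegularLocalRing (A'.Z.presheaf.stalk ξ'))
    (κ : K →+* A.Z.presheaf.stalk (π.base ξ')) (κ' : K →+* A'.Z.presheaf.stalk ξ')
    (hκκ' : ∀ l, (π.stalkMap ξ').hom (κ l) = κ' l) (hrat : ∀ r, ∃ l : K, r - κ' l ∈ maximalIdeal _)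
    (hij : i ≠ j) (htwo : ∀ l, l = j ∨ l = i)
    {x y z : A.Z.presheaf.stalk (π.base ξ')} (hxyz : Ideal.span {x, y, z} = maximalIdeal _)
    (s : State σ K) (hdeg : ∀ d ∈ s.F.support, p ≤ d.degree)
    (hJ : stalkIdeal E.J (π.base ξ') = Ideal.span {z ^ p + eval₂ κ (fun l => if l = j then x else y) s.F}) :
    ∃ (c : σ) (b : σ → K) (x' y' z' : A'.Z.presheaf.stalk ξ'),
      b c = 0 ∧ (c = i → ∀ l, b l = 0) ∧ IsEquimultiplePoint p c b s ∧
      Ideal.span {x', y', z'} = maximalIdeal _ ∧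
      stalkIdeal (E.transform π D).J ξ' =
        Ideal.span {z' ^ p + eval₂ κ' (fun l => if l = j then x' else y') (step p c b s).F} := by
  classical
  haveI : IsLocallyNoetherian A'.Z := by
    haveI := A'.smooth
    exact LocallyOfFiniteType.isLocallyNoetherian A'.hom
  haveI := hreg'
  haveI : IsDomain (A'.Z.presheaf.stalk ξ') := isDomain_of_isRegularLocalRing _
  set ψ := (π.stalkMap ξ').hom with hψ
  -- the first chart presentation w.r.t. `(x, y, z)`
  set c₀ : Fin 3 → A.Z.presheaf.stalk (π.base ξ') := ![x, y, z] with hc₀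
  have hc₀span : Ideal.span (Set.range c₀) = maximalIdeal _ := by
    rw [hc₀, MohWindowSurfaceResidualOrder.range_vec3]; exact hxyz
  have hY : stalkIdeal (vanishingIdeal D) (π.base ξ') = maximalIdeal _ :=
    stalkIdeal_vanishingIdeal_eq_maximalIdeal_of_closure_eq (by rw [hD, hξcl.closure_eq])
  have hc₀Y : Ideal.span (Set.range c₀) = stalkIdeal (vanishingIdeal D) (π.base ξ') := hc₀span.trans hY.symm
  obtain ⟨j₀, 𝔴₀, χ₀, hχ₀, hloc₀, -⟩ := hπ.exists_reesChart_stalk ξ' c₀ hc₀Y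
  have hrel₀ : ∀ l, ψ (c₀ l) = ψ (c₀ j₀) * χ₀ (chartGen c₀ j₀ l) := stalkMap_apply_eq_mul_chartGen j₀ χ₀ hχ₀
  have hne₀ : ψ (c₀ j₀) ≠ 0 := stalkMap_apply_ne_zero_of_chart j₀ 𝔴₀ χ₀ hχ₀ hloc₀
  set q : Fin 3 → A'.Z.presheaf.stalk ξ' := fun l => χ₀ (chartGen c₀ j₀ l) with hq
  have hqself : q j₀ = 1 := by
    have h := hrel₀ j₀
    conv_lhs at h => rw [← mul_one (ψ (c₀ j₀))]
    exact (mul_left_cancel₀ hne₀ h).symm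
  have hJ' : stalkIdeal E.J (π.base ξ') = Ideal.span {c₀ 2 ^ p + eval₂ κ (fun l => if l = j then x else y) s.F} := hJ
  -- quotients relative to a unit among them
  have hρ_of_unit : ∀ {m : Fin 3} (u : (A'.Z.presheaf.stalk ξ')ˣ), (u : A'.Z.presheaf.stalk ξ') = q m →
      (∀ l, ψ (c₀ l) = ψ (c₀ m) * (q l * ↑u⁻¹)) ∧ ψ (c₀ m) ≠ 0 := by
    intro m u hu
    have hu' : χ₀ (chartGen c₀ j₀ m) = ↑u := hu.symm
    refine ⟨fun l => ?_, ?_⟩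
    · rw [hrel₀ l, hrel₀ m, hu']
      show ψ (c₀ j₀) * q l = ψ (c₀ j₀) * ↑u * (q l * ↑u⁻¹)
      calc ψ (c₀ j₀) * q l = ψ (c₀ j₀) * ((u : A'.Z.presheaf.stalk ξ') * ↑u⁻¹) * q l := by
            rw [Units.mul_inv, mul_one]
        _ = ψ (c₀ j₀) * ↑u * (q l * ↑u⁻¹) := by ring
    · rw [hrel₀ m, hu']; exact mul_ne_zero hne₀ (Units.ne_zero u)
  by_cases hA : IsUnit (q 0)
  · -- chart of the letter `j`
    obtain ⟨u, hu⟩ := hA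
    obtain ⟨hρ, hX0⟩ := hρ_of_unit u hu
    obtain ⟨a₁, ha₁⟩ := hrat (q 1 * ↑u⁻¹)
    obtain ⟨a₂, ha₂⟩ := hrat (q 2 * ↑u⁻¹)
    obtain ⟨xc, xc', w', heq, h𝔪, hJ''⟩ := exists_anchor_of_chart π hπ hsing' hb h3 hreg' κ κ' hκκ' hij htwo c₀ hc₀span
      hc₀Y (fun l => if l = j then x else y) (mc := 0) (mc' := 1) (Or.inl ⟨rfl, rfl⟩) (by rw [if_pos rfl]; rfl)
      (by rw [if_neg hij]; rfl) s hdeg hJ' _ hρ hX0 ![0, a₁, a₂] (fun l hl => by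
        fin_cases l
        · exact absurd rfl hl
        · exact ha₁
        · exact ha₂)
    refine ⟨j, _, xc, xc', w', if_pos rfl, fun h => absurd h.symm hij, heq, h𝔪, hJ''⟩
  by_cases hB : IsUnit (q 1)
  · -- chart of the letter `i`, at its origin
    obtain ⟨u, hu⟩ := hB
    obtain ⟨hρ, hX0⟩ := hρ_of_unit u hu
    have hq0 : q 0 * ↑u⁻¹ ∈ maximalIdeal (A'.Z.presheaf.stalk ξ') :=
      Ideal.mul_mem_right _ _ ((IsLocalRing.mem_maximalIdeal _).mpr hA)
    obtain ⟨a₂, ha₂⟩ := hrat (q 2 * ↑u⁻¹)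
    obtain ⟨xc, xc', w', heq, h𝔪, hJ''⟩ := exists_anchor_of_chart π hπ hsing' hb h3 hreg' κ κ' hκκ' hij.symm
      (fun l => (htwo l).symm) c₀ hc₀span hc₀Y (fun l => if l = j then x else y) (mc := 1) (mc' := 0) (Or.inr ⟨rfl, rfl⟩)
      (by rw [if_neg hij]; rfl) (by rw [if_pos rfl]; rfl) s hdeg hJ' _ hρ hX0 ![0, 0, a₂] (fun l hl => by
        fin_cases l
        · show q 0 * ↑u⁻¹ - κ' 0 ∈ _
          rw [map_zero, sub_zero]; exact hq0
        · exact absurd rfl hl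
        · exact ha₂)
    have hb0 : (fun l => if l = i then (0 : K) else (![0, 0, a₂] : Fin 3 → K) 0) = fun _ => 0 := by
      funext l; split_ifs <;> rfl
    rw [hb0] at heq hJ''
    have hfun : (fun l => if l = i then xc else xc') = fun l => if l = j then xc' else xc := by
      funext l
      rcases htwo l with rfl | rfl
      · rw [if_neg (fun h => hij h.symm), if_pos rfl]
      · rw [if_pos rfl, if_neg hij]
    rw [hfun] at hJ''
    refine ⟨i, fun _ => 0, xc', xc, w', rfl, fun _ _ => rfl, heq, ?_, hJ''⟩
    rw [← h𝔪, Set.insert_comm]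
  · -- only the `z`-chart: impossible at a singular point
    have hq0 : q 0 ∈ maximalIdeal _ := (IsLocalRing.mem_maximalIdeal _).mpr hA
    have hq1 : q 1 ∈ maximalIdeal _ := (IsLocalRing.mem_maximalIdeal _).mpr hB
    have hj₀ : j₀ = 2 := by
      fin_cases j₀
      · exact absurd (hqself ▸ isUnit_one) hA
      · exact absurd (hqself ▸ isUnit_one) hB
      · rfl
    subst hj₀
    have hbE' : (E.transform π D).b = E.b := rfl
    have hCmap : (stalkIdeal (vanishingIdeal D) (π.base ξ')).map ψ = Ideal.span {ψ (c₀ 2)} := by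
      rw [← hc₀Y, Ideal.map_span_range_eq_span_singleton _ c₀ 2 _ hrel₀]
    have hstalk : stalkIdeal (E.transform π D).J ξ' =
        Submodule.colon (Ideal.span {ψ (z ^ p + eval₂ κ (fun l => if l = j then x else y) s.F)})
          ((Ideal.span {ψ z} ^ p : Ideal _) : Set _) := by
      show stalkIdeal (controlledTransform π (vanishingIdeal D) E.J E.b) ξ' = _
      rw [controlledTransform, stalkIdeal_colon, stalkIdeal_pow, stalkIdeal_comap_eq_map_stalkMap,
        stalkIdeal_comap_eq_map_stalkMap, ← hψ, hCmap, hJ, Ideal.map_span, Set.image_singleton, hb]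
      rfl
    have hsing : stalkIdeal (E.transform π D).J ξ' ≤ maximalIdeal _ ^ p := by
      have := (le_idealOrder_iff (E.transform π D).J ξ' (E.transform π D).b).mp hsing'
      rwa [hbE', hb] at this
    exact (false_of_zChart ψ κ s hdeg (hrel₀ 0) (hrel₀ 1) hq0 hq1 hne₀ hstalk hsing).elim

end MohWindowShadeAnchorStep

end CampaignW46

end Summit.ResolutionOfSingularities.ResolutionOfSingularities.Theorems

end
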